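import Mathlib.Algebra.MvPolynomial.Monad
import Mathlib.Data.Finsupp.Lex
import Mathlib.SetTheory.Cardinal.Order
import Literature.Computability.AlgebraicComplexity.Forbes15SupportBound
import Literature.Computability.AlgebraicComplexity.FSV18SuccinctGenerators
import HarnessLib

/-!
# Forbes 2015, Prop. 6.5 (`m = 1`) and FSV 2018 Lemma 36 — small-support monomials in
translations of `Σm∧ΣΠ^t` formulas

M. A. Forbes, *Deterministic divisibility testing via shifted partial derivatives*, FOCS 2015
(doi:10.1109/FOCS.2015.35; held `paper:doi-10-1109-focs-2015-35`), **Prop. 6.5:** «Let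
`f(x) ∈ 𝔽[x_1,…,x_n]`, `t ≥ 1`, and `α ∈ (𝔽∖{0})^n` be of full-support. Suppose that `f` is a
non-zero polynomial of the form `f(x) = Σ_{i=1}^s x^{b_i} f_i(g_{i,1}(x),…,g_{i,m}(x))` where
`deg g_{i,j} ≤ t`. Let `x^a` be the trailing monomial of `f(x+α)`. If `char(𝔽) > ideg x^a`, then
`‖a‖₀ ≤ 2e³(t+1)(ln s + m ln(2m) + 1)`. In particular, for `m = O(1)`, `‖a‖₀ ≤ O(t ln s)`.»  Here
`m = 1`, `f_i(y) = y^{d_i}` — the `Σm∧ΣΠ^t` formulas of FSV Def. 35 — with the constant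
`9(t+2)3^t` (see `Forbes15SupportBound`).  Proof as printed (p. 32–33): take the trailing monomial
`x^a` of `f(x+α)`, project onto the variables `S = Supp(a)` (Lemma 4.12 — here the algebra map `ψ`
killing `x_j`, `j ∉ S`, and renaming `S ≅ Fin |S|`), observe that the projection «is of the same
form and complexity», and compare the two bounds on the measure (`card_lt_of_isTrailing`).

M. A. Forbes, A. Shpilka, B. L. Volk, *Succinct hitting sets and barriers to proving lower bounds
for algebraic circuits*, ToC 14 (2018), **Lemma 36** (= ToC Lemma 5.12; arXiv:1701.05328
p. 19): «Suppose `F[X]` is computed by a `Σm∧ΣΠ^{O(1)}` formula of top fan-in `s`, and let `α` be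
a full-support vector. Then `F(X + α)` has a monomial of support at most `O(log s)`» — «proved in
[Forbes15]».  FSV state no characteristic hypothesis; the cited proof needs the exponents of the
trailing monomial to be nonzero in `𝔽` (Forbes Remark 4.16: «most of the results of this paper are
restricted to polynomially large characteristic»), which holds when `char 𝔽 = 0` or
`char 𝔽 > deg F`.  The typed fact `FSV2018_lemma36` carries exactly that clause (file-B pass 4,
val-lit ruling (17)); this file discharges it (`FSV2018_lemma36_holds`).  The clause-free printed
sentence is not known to follow from any source in characteristic `0 < p ≤ deg F`.

* `totalDegree_aeval_le_of_le_one` — substitutions by polynomials of degree `≤ 1` do not raise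
  the total degree.
* `aeval_X_add_C_ne_zero` — translation `X ↦ X + α` is injective.
* `coeff_killRename` — coefficients of the projection-plus-renaming `ψ` (Lemma 4.12).
* **`forbes2015_prop_6_5`** — for `P = Σ_{i<s} X^{a_i} G_i^{d_i}`, `deg G_i ≤ t`, `P ≠ 0`, `α` of
  full support, and all exponents of monomials of `P(X+α)` nonzero in `F`:
  `P(X+α)` has a monomial of support `< 9(t+2)3^t(⌊log₂ s⌋+1)`.
* **`FSV2018_lemma36_holds`** — the named fact `FSV2018_lemma36` (file-B pass 4 text, with the
  clause `ringChar F = 0 ∨ P.totalDegree < ringChar F`) DISCHARGED.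
-/

open MvPolynomial
open Finsupp (embDomain comapDomain embDomain_comapDomain prod_embDomain embDomain_injective
  embDomain_notin_range embDomain_eq_mapDomain comapDomain_apply)

namespace Literature.Computability.AlgebraicComplexity.Forbes15

variable {F : Type*} [Field F]

/-! ### Degree under affine substitutions; injectivity of translation -/

/-- A substitution `X_j ↦ f_j` with `deg f_j ≤ 1` does not raise the total degree.
[cite: Forbes2015, Prop. 6.5 (proof: «deg_y ĝ_{i,j} ≤ deg_x g_{i,j}»)] -/
theorem totalDegree_aeval_le_of_le_one {ι τ : Type*} (f : ι → MvPolynomial τ F)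
    (hf : ∀ j, (f j).totalDegree ≤ 1) (p : MvPolynomial ι F) :
    (aeval f p).totalDegree ≤ p.totalDegree := by
  classical
  conv_lhs => rw [p.as_sum]
  rw [map_sum]
  refine totalDegree_finsetSum_le fun b hb => ?_
  rw [aeval_monomial, MvPolynomial.algebraMap_eq]
  calc (C (coeff b p) * b.prod fun i k => f i ^ k).totalDegree
      ≤ (C (coeff b p) : MvPolynomial τ F).totalDegree +
          (b.prod fun i k => f i ^ k).totalDegree := totalDegree_mul _ _
    _ ≤ 0 + b.sum fun _ e => e := by
        refine add_le_add (by rw [totalDegree_C]) ?_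
        unfold Finsupp.prod Finsupp.sum
        refine (totalDegree_finsetProd _ _).trans (Finset.sum_le_sum fun i _ => ?_)
        exact (totalDegree_pow _ _).trans (by simpa using Nat.mul_le_mul_left (b i) (hf i))
    _ ≤ p.totalDegree := by rw [zero_add]; exact le_totalDegree hb

/-- `deg (X_j + α_j) ≤ 1`. [cite: Forbes2015, §5.1] -/
theorem totalDegree_X_add_C_le_one {ι : Type*} (α : ι → F) (j : ι) :
    (X j + C (α j) : MvPolynomial ι F).totalDegree ≤ 1 :=
  totalDegree_X_add_C_le j (α j)

/-- Translation `P ↦ P(X + α)` is injective (inverse `X ↦ X − α`).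
[cite: Forbes2015, §5.1 (translation `x ↦ x + α` is an automorphism)] -/
theorem aeval_X_add_C_ne_zero {ι : Type*} (α : ι → F) {P : MvPolynomial ι F} (hP : P ≠ 0) :
    aeval (fun i => (X i + C (α i) : MvPolynomial ι F)) P ≠ 0 := by
  intro h
  apply hP
  have key : bind₁ (fun i => (X i - C (α i) : MvPolynomial ι F))
      (bind₁ (fun i => (X i + C (α i) : MvPolynomial ι F)) P) = P := by
    rw [bind₁_bind₁]
    have : (fun i => bind₁ (fun i => (X i - C (α i) : MvPolynomial ι F)) (X i + C (α i))) =
        (X : ι → MvPolynomial ι F) := by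
      funext i
      rw [map_add, bind₁_X_right, bind₁_C_right, sub_add_cancel]
    rw [this, bind₁_X_left, AlgHom.id_apply]
  rw [aeval_eq_bind₁] at h
  rw [← key, h, map_zero]

/-! ### The lexicographic rank and the projection `ψ` (Forbes Lemma 4.12) -/

section Transport

variable {ι : Type*} (S : Finset ι)

/-- `embOf S` lands in `S`. [cite: Forbes2015, Lemma 4.12] -/
theorem embOf_mem (j : Fin S.card) : embOf S j ∈ S := (S.equivFin.symm j).2

/-- `embOf S` enumerates exactly `S`. [cite: Forbes2015, Lemma 4.12] -/
theorem range_embOf : Set.range (embOf S) = (S : Set ι) := by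
  ext j
  refine ⟨?_, fun hj => ⟨S.equivFin ⟨j, hj⟩, ?_⟩⟩
  · rintro ⟨j', rfl⟩; exact embOf_mem S j'
  · show (S.equivFin.symm (S.equivFin ⟨j, hj⟩)).1 = j
    rw [Equiv.symm_apply_apply]

/-- `ψ(x_{emb j'}) = x_{j'}`. [cite: Forbes2015, Lemma 4.12] -/
theorem killVar_embOf (j : Fin S.card) : killVar (F := F) S (embOf S j) = X j := by
  unfold killVar
  rw [dif_pos (embOf_mem S j)]
  have : (⟨embOf S j, embOf_mem S j⟩ : S) = S.equivFin.symm j := Subtype.ext rfl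
  rw [this, Equiv.apply_symm_apply]

/-- `ψ(x_j) = 0` off `S`. [cite: Forbes2015, Lemma 4.12] -/
theorem killVar_of_not_mem {j : ι} (hj : j ∉ S) : killVar (F := F) S j = 0 := by
  unfold killVar
  rw [dif_neg hj]

/-- The images of the variables under `ψ` have degree `≤ 1`. [cite: Forbes2015, Lemma 4.12] -/
theorem totalDegree_killVar_le (j : ι) : (killVar (F := F) S j).totalDegree ≤ 1 := by
  unfold killVar
  split_ifs
  · exact (totalDegree_X _).le
  · rw [totalDegree_zero]; exact zero_le_one

/-- **Forbes Lemma 4.12 (coefficients of the projection):** the `b'`-coefficient of `ψ p` is the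
`emb(b')`-coefficient of `p`. [cite: Forbes2015, Lemma 4.12] -/
theorem coeff_killRename (p : MvPolynomial ι F) (b' : Fin S.card →₀ ℕ) :
    coeff b' (aeval (killVar (F := F) S) p) = coeff (embDomain (embOf S) b') p := by
  classical
  induction p using MvPolynomial.induction_on' with
  | add p q hp hq => rw [map_add, coeff_add, coeff_add, hp, hq]
  | monomial b a =>
    rw [aeval_monomial, MvPolynomial.algebraMap_eq, coeff_monomial]
    by_cases hb : (b.support : Set ι) ⊆ S
    · -- `b` is supported in `S`: `ψ(x^b) = x^{b₀}` with `emb(b₀) = b`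
      have hb' : (b.support : Set ι) ⊆ Set.range (embOf S) := by rwa [range_embOf]
      set b₀ := comapDomain (embOf S) b (embOf S).injective.injOn with hb₀
      have heb : embDomain (embOf S) b₀ = b := embDomain_comapDomain hb'
      have hprod : (b.prod fun i k => killVar (F := F) S i ^ k) = monomial b₀ 1 := by
        rw [← heb, prod_embDomain, monomial_eq, C_1, one_mul]
        simp only [killVar_embOf]
      rw [hprod, C_mul_monomial, mul_one, coeff_monomial]
      rcases eq_or_ne b₀ b' with h | h
      · subst h; rw [if_pos rfl, if_pos heb.symm]
      · rw [if_neg h, if_neg (fun h' => h (embDomain_injective _ (heb.trans h')))]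
    · -- some variable of `b` lies outside `S`: both sides vanish
      rw [Set.not_subset] at hb
      obtain ⟨j, hjb, hjS⟩ := hb
      have hjb' : j ∈ b.support := hjb
      have hprod : (b.prod fun i k => killVar (F := F) S i ^ k) = 0 := by
        unfold Finsupp.prod
        refine Finset.prod_eq_zero hjb' ?_
        dsimp only
        rw [killVar_of_not_mem S hjS, zero_pow (Finsupp.mem_support_iff.mp hjb')]
      rw [hprod, mul_zero, coeff_zero, if_neg]
      rintro rfl
      have : embDomain (embOf S) b' j = 0 :=
        embDomain_notin_range _ _ _ (by rw [range_embOf]; exact hjS)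
      exact (Finsupp.mem_support_iff.mp hjb') this

end Transport

/-! ### Prop. 6.5 (`m = 1`) -/

/-- **Forbes 2015, Prop. 6.5 (`m = 1`: sums of monomials times powers of degree-`≤ t`
polynomials).** Let `P = Σ_{i<s} X^{a_i}·G_i^{d_i}` with `deg G_i ≤ t`, `P ≠ 0`, and `α` of full
support; assume the exponents occurring in `P(X+α)` are nonzero in `F` (automatic when
`char F = 0` or `char F > deg P`; print asks it of the trailing monomial only). Then `P(X + α)`
has a monomial of support `< 9(t+2)3^t·(⌊log₂ s⌋ + 1)` (print: its trailing monomial, with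
`‖a‖₀ ≤ 2e³(t+1)(ln s + ln 2 + 1)`). [cite: Forbes2015, Prop. 6.5] -/
theorem forbes2015_prop_6_5 {ι : Type*} {s t : ℕ} (a : Fin s → ι →₀ ℕ)
    (G : Fin s → MvPolynomial ι F) (d : Fin s → ℕ) (hG : ∀ i, (G i).totalDegree ≤ t)
    (hP : (∑ i, monomial (a i) 1 * G i ^ d i) ≠ 0) (α : ι → F) (hα : ∀ i, α i ≠ 0)
    (hexp : ∀ m ∈ (aeval (fun i => (X i + C (α i) : MvPolynomial ι F))
      (∑ i, monomial (a i) 1 * G i ^ d i)).support, ∀ j ∈ m.support, ((m j : ℕ) : F) ≠ 0) :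
    ∃ m ∈ (aeval (fun i => (X i + C (α i) : MvPolynomial ι F))
      (∑ i, monomial (a i) 1 * G i ^ d i)).support,
      m.support.card < 9 * (t + 2) * 3 ^ t * (Nat.log 2 s + 1) := by
  classical
  letI : LinearOrder ι := IsWellOrder.linearOrder WellOrderingRel
  set θ : ι → MvPolynomial ι F := fun i => X i + C (α i) with hθ
  set g := aeval θ (∑ i, monomial (a i) 1 * G i ^ d i) with hg
  have hg0 : g ≠ 0 := aeval_X_add_C_ne_zero α hP
  have hne : g.support.Nonempty := by
    rw [Finset.nonempty_iff_ne_empty, Ne, MvPolynomial.support_eq_empty]; exact hg0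
  obtain ⟨a₀, ha₀, hmin⟩ := g.support.exists_min_image (fun m => toLex m) hne
  refine ⟨a₀, ha₀, ?_⟩
  -- project onto `S = Supp(a₀)` and rename `S ≅ Fin |S|`
  set S := a₀.support with hS
  let emb := embOf S
  let ψ : MvPolynomial ι F →ₐ[F] MvPolynomial (Fin S.card) F := aeval (killVar S)
  let r : (Fin S.card →₀ ℕ) →+ Lex (ι →₀ ℕ) := (lexRank ι).comp (Finsupp.embDomain.addMonoidHom emb)
  have hr_apply : ∀ b, r b = toLex (embDomain emb b) := fun _ => rfl
  have hr : Function.Injective r := fun b₁ b₂ h => by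
    rw [hr_apply, hr_apply] at h
    exact embDomain_injective emb (toLex.injective h)
  have hmono : Monotone r := fun b₁ b₂ h => by
    rw [hr_apply, hr_apply]
    refine Finsupp.toLex_monotone ?_
    rw [embDomain_eq_mapDomain, embDomain_eq_mapDomain]
    exact Finsupp.mapDomain_mono h
  -- the trailing monomial of `ψ g`
  set a₀' : Fin S.card →₀ ℕ := comapDomain emb a₀ emb.injective.injOn with ha₀'
  have hea : embDomain emb a₀' = a₀ := embDomain_comapDomain (by rw [range_embOf])
  have htrail : IsTrailing r (ψ g) a₀' := by
    refine ⟨?_, fun b hb => ?_⟩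
    · rw [coeff_killRename, hea]; exact MvPolynomial.mem_support_iff.mp ha₀
    · rw [MvPolynomial.mem_support_iff, coeff_killRename] at hb
      rw [hr_apply, hr_apply, hea]
      exact hmin _ (MvPolynomial.mem_support_iff.mpr hb)
  have hfull : ∀ j, ((a₀' j : ℕ) : F) ≠ 0 := fun j => by
    rw [ha₀', comapDomain_apply]
    exact hexp a₀ ha₀ _ (embOf_mem S j)
  -- `ψ g` «is of the same form and complexity»
  set α' : Fin S.card → F := fun j => α (emb j) with hα'
  have hα'0 : ∀ j, α' j ≠ 0 := fun j => hα _
  have hshape : ψ g = ∑ i, ψ (aeval θ (monomial (a i) (1 : F))) * (ψ (aeval θ (G i))) ^ d i := by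
    rw [hg, map_sum, map_sum]
    refine Finset.sum_congr rfl fun i _ => ?_
    rw [map_mul, map_pow, map_mul, map_pow]
  have hLA : ∀ i, LogAffine α' (ψ (aeval θ (monomial (a i) (1 : F)))) := by
    intro i
    simp only [aeval_monomial, map_one, one_mul]
    unfold Finsupp.prod
    rw [map_prod]
    refine LogAffine.prod _ _ fun j _ => ?_
    rw [map_pow]
    refine LogAffine.pow ?_ _
    show LogAffine α' (aeval (killVar S) (X j + C (α j)))
    rw [map_add, aeval_X, aeval_C, MvPolynomial.algebraMap_eq]
    by_cases hj : j ∈ S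
    · have hj' : emb (S.equivFin ⟨j, hj⟩) = j := by
        show (S.equivFin.symm (S.equivFin ⟨j, hj⟩)).1 = j
        rw [Equiv.symm_apply_apply]
      have h1 : killVar (F := F) S j = X (S.equivFin ⟨j, hj⟩) := by
        conv_lhs => rw [← hj']
        exact killVar_embOf S _
      have h2 : α j = α' (S.equivFin ⟨j, hj⟩) := by
        rw [hα']; simp only; rw [hj']
      rw [h1, h2]
      exact LogAffine.X_add_C α' _
    · rw [killVar_of_not_mem S hj, zero_add]
      exact LogAffine.const α' _
  have hdeg : ∀ i, (ψ (aeval θ (G i))).totalDegree ≤ t := fun i =>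
    (totalDegree_aeval_le_of_le_one _ (totalDegree_killVar_le S) _).trans
      ((totalDegree_aeval_le_of_le_one _ (totalDegree_X_add_C_le_one α) _).trans (hG i))
  rw [hshape] at htrail
  exact card_lt_of_isTrailing (d := d) hr hmono hα'0 hLA hdeg htrail hfull

end Literature.Computability.AlgebraicComplexity.Forbes15

/-! ### FSV 2018 Lemma 36, with the characteristic clause of its source -/

namespace Literature.Computability.AlgebraicComplexity

/-- **FSV Lemma 36 (ToC Lemma 5.12) [Forbes 2015, Prop. 6.5] — the named fact
`FSV2018_lemma36` DISCHARGED** (text of record = file-B pass 4, which carries the characteristic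
clause `ringChar F = 0 ∨ P.totalDegree < ringChar F` of the cited source): for every bottom
degree `t` there is `c` (here `9(t+2)3^t`) such that over every field `F`, every nonzero
`Σm∧ΣΠ^t` formula `P` of top fan-in `s` with `char F = 0` or `char F > deg P`, shifted by a
full-support `α`, has a monomial of support `≤ c(⌊log₂ s⌋ + 1)`.  Proof: `forbes2015_prop_6_5`;
the clause makes every exponent occurring in `P(X+α)` (all `≤ deg P`) nonzero in `F`.
[cite: ForbesShpilkaVolk2018, Lemma 36 (seq.) = ToC Lemma 5.12, p. 26; Forbes2015, Prop. 6.5]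
locator: paper:arxiv-1701.05328 p0019.txt:L66; paper:doi-10-1109-focs-2015-35 p0032.txt:L27 -/
theorem FSV2018_lemma36_holds : FSV2018_lemma36 := by
  intro t
  refine ⟨9 * (t + 2) * 3 ^ t, ?_⟩
  intro F _ ι P s hP hP0 hchar α hα
  obtain ⟨a, G, d, hG, rfl⟩ := hP
  have hexp : ∀ m ∈ (aeval (fun i => (X i + C (α i) : MvPolynomial ι F))
      (∑ i, monomial (a i) 1 * G i ^ d i)).support, ∀ j ∈ m.support, ((m j : ℕ) : F) ≠ 0 := by
    intro m hm j hj hzero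
    rw [ringChar.spec] at hzero
    have hmj : m j ≠ 0 := Finsupp.mem_support_iff.mp hj
    rcases hchar with h0 | hlt
    · rw [h0, zero_dvd_iff] at hzero; exact hmj hzero
    · have h1 : m j ≤ (∑ i, monomial (a i) 1 * G i ^ d i).totalDegree := by
        refine le_trans ?_ ((le_totalDegree hm).trans (Forbes15.totalDegree_aeval_le_of_le_one _
          (Forbes15.totalDegree_X_add_C_le_one α) _))
        exact Finset.single_le_sum (fun _ _ => Nat.zero_le _) hj
      exact absurd (Nat.le_of_dvd (Nat.pos_of_ne_zero hmj) hzero) (by omega)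
  obtain ⟨m, hm, hlt⟩ := Forbes15.forbes2015_prop_6_5 a G d hG hP0 α hα hexp
  exact ⟨m, hm, hlt.le⟩

end Literature.Computability.AlgebraicComplexity
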